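import Summits.Ventures.HodgeKum4.Theorems.KummerFixedLocusPointCount
import Summits.Ventures.HodgeKum4.Theorems.KummerFixedLocusSplitPoints
import HarnessLib

/-!
# The point count at the Kummer varieties from TRANSITIVITY and ONE FIXED POINT (the torsor road)
(cell `hodge-kum4`, seat p2 — interface items J1 + final assembly of HOME/p2/D3-INTERFACE.md r2;
shape found by seat p1, HOME/p1/count/COUNT-SHAPE.md; director-hodge 2026-08-26T07:34:45Z / 07:45:26Z)

HONEST FRAMING.  Nothing here proves the point count `Kum4FixedPointCountAtKummer` (item
stmt-Ventures-19504, the residual of the fixed-locus branch), (H3) or the Hodge conjecture.  PROVED: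
* (J1 is seat p1's `SplitPoints.injective` / `SplitPoints.exists_eq`, module
  `KummerFixedLocusSplitPoints`: the split sections are pairwise distinct and exhaust the sections.)
* §J3 `eq_of_fixed_of_transitive` — the odd-torsor lemma in the form used here: a group whose
  elements have odd order, acting transitively on a set `S` through `act`, and `σ : S → S` with
  `σ (act p a) = act p⁻¹ (σ a)`: two `σ`-fixed points coincide (p1's
  `OddTorsor.existsUnique_fixedPoint_of_smul_inv`, uniqueness half, instance-free).
* `kum4FixedPointCountAtKummer_of_transitive_of_hasFixedPoint` — THE ASSEMBLY:
  (print) `FloccariVaresco2024_autFixingH2H3_equiv_kumType` (`Γ ≅ (ℤ/5)⁴`: commutative, odd) +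
  (H2) transitivity of `Γ(K⁴(A))` on the `g`-fixed points (printed synthesis from Oguiso 2020
  Prop. 3.6, the tree's named fact `Hyperkaehler.Oguiso2020_translations_transitive_fixedPoints_generalizedKummerFour`,
  p431381, BY NAME) + (H3) "the fixed fourfold of every Kummer datum on `K⁴(A)` contains a
  `g`-fixed point" (the cell's elementary unpublished ATOM, inline hypothesis; p1's
  `Kum4FixedFourfoldHasFixedPointAtKummer`) ⟹ `Kum4FixedPointCountAtKummer`.
-/

noncomputable section

open CategoryTheory CategoryTheory.Limits MonoidalCategory CartesianMonoidalCategory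
open AlgebraicGeometry
open Literature.AlgebraicGeometry Literature.AlgebraicGeometry.Hyperkaehler
open Literature.AlgebraicGeometry.GroupActions

namespace Summit.Ventures.HodgeKum4

/-! ### §J3 The odd-torsor lemma (uniqueness of the fixed point), instance-free form -/

/-- **Odd torsor with an inverting involution: at most one fixed point.**  Let a group `P` all of
whose elements have odd order act on `S` (`act`, multiplicative), transitively, and let `σ : S → S`
satisfy `σ (act p a) = act p⁻¹ (σ a)`.  Then two `σ`-fixed points coincide: if `b = act p a` then
`σ b = act p⁻¹ a`, so `act (p²) a = a`, and `p = (p²)^(m+1)` fixes `a`. -/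
theorem eq_of_fixed_of_transitive {P S : Type*} [Group P] (act : P → S → S)
    (act_one : ∀ s, act 1 s = s) (act_mul : ∀ p q s, act (p * q) s = act p (act q s))
    (hodd : ∀ p : P, ∃ m : ℕ, p ^ (2 * m + 1) = 1) (htrans : ∀ a b : S, ∃ p, act p a = b)
    (σ : S → S) (hσ : ∀ p a, σ (act p a) = act p⁻¹ (σ a)) {a b : S} (ha : σ a = a) (hb : σ b = b) :
    a = b := by
  obtain ⟨p, rfl⟩ := htrans a b
  -- `act (p * p) a = a`
  have h2 : act (p * p) a = a := by
    have h := hσ p a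
    rw [hb, ha] at h
    -- `act p a = act p⁻¹ a` ⇒ apply `act p`
    have := congrArg (act p) h
    rwa [← act_mul, ← act_mul, mul_inv_cancel, act_one] at this
  -- powers of `p * p` fix `a`
  have hpow : ∀ j : ℕ, act ((p * p) ^ j) a = a := by
    intro j
    induction j with
    | zero => rw [pow_zero, act_one]
    | succ j ih => rw [pow_succ, act_mul, h2, ih]
  obtain ⟨m, hm⟩ := hodd p
  have hkey : (p * p) ^ (m + 1) = p := by
    rw [← pow_two, ← pow_mul, show 2 * (m + 1) = (2 * m + 1) + 1 by ring, pow_succ, hm, one_mul]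
  have h := hpow (m + 1)
  rw [hkey] at h
  exact h.symm

/-! ### The assembly: (print) + (H2) transitivity + (H3) one fixed point ⇒ the point count -/

/-- **The point count from transitivity and one fixed point** (the torsor road; p1's COUNT-SHAPE).
Inputs: `Γ(X) ≅ (ℤ/5)⁴` for `Kum⁴`-type `X` (Floccari–Varesco, REFEREED; gives commutativity and
odd order); (H2) TRANSITIVITY of `Γ(K⁴(A))` on the `g`-fixed `ℂ`-points (printed synthesis from
Oguiso 2020 Prop. 3.6 — the named fact `Hyperkaehler.Oguiso2020_translations_transitive_fixedPoints_generalizedKummerFour`); (H3) EXISTENCE of a `g`-fixed `ℂ`-point on the fixed fourfold of every Kummer datum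
on `K⁴(A)` (the cell's ATOM; p1's `Kum4FixedFourfoldHasFixedPointAtKummer`, `@[conjecture]` def in `KummerFixedLocusDefs`, BY NAME).  Then
`Kum4FixedPointCountAtKummer`: among the `125` split sections of the fixed-point scheme of `⟨g⟩`,
exactly one lies on `W₀` — existence by (H3) and §J1, uniqueness because points of `W₀` are
`ι₀`-fixed, `ι₀` inverts the commutative odd-order `Γ` acting transitively (§J3), `j` is mono and
the sections are injective (p1's `SplitPoints.injective`). -/
theorem kum4FixedPointCountAtKummer_of_transitive_of_hasFixedPoint
    (hFV : FloccariVaresco2024_autFixingH2H3_equiv_kumType)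
    (hH2 : Oguiso2020_translations_transitive_fixedPoints_generalizedKummerFour)
    (hH3 : Kum4FixedFourfoldHasFixedPointAtKummer) :
    Kum4FixedPointCountAtKummer := by
  intro A K hA hKum hK8 ι₀ W₀ i₀ hd g hg F j hj x hx
  obtain ⟨hx⟩ := hx
  -- `K` is of `Kum⁴`-type; `Γ(K) ≅ (ℤ/5)⁴`
  obtain ⟨M⟩ := HodgeTheory.nonempty_hodgeModel_holds (n := 8) (X := K) hK8
  have hKK : IsOfGeneralizedKummerType 4 K := IsOfGeneralizedKummerType.of_hodgeModel (n := 4) hA hKum hK8 M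
  obtain ⟨e⟩ := hFV 4 (by norm_num) hK8 hKK
  have hcomm : ∀ p q : autFixingH2H3 K, p * q = q * p := fun p q =>
    e.injective ((e.map_mul p q).trans ((mul_comm _ _).trans (e.map_mul q p).symm))
  have hcard : Nat.card (autFixingH2H3 K) = 625 :=
    FloccariVaresco2024_autFixingH2H3_equiv_kumType.floccari2026_card hFV hK8 hKK
  -- `j` is invariant and mono; `i₀` is mono
  have hjg : j ≫ g.val.hom = j := hj.comp_hom ⟨g.val, Subgroup.mem_zpowers g.val⟩
  haveI : Mono j := hj.toIsFixedPointObject.mono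
  haveI := hd.isClosedImmersion
  haveI : Mono i₀ := Over.mono_of_mono_left i₀
  -- existence: the `g`-fixed point of `W₀` from (H3) is one of the sections
  obtain ⟨p₀, hp₀⟩ := hH3 hA hKum hK8 ι₀ i₀ hd g hg
  have hinv₀ : ∀ a : Subgroup.zpowers g.val,
      (p₀ ≫ i₀) ≫ ((Subgroup.zpowers g.val).subtype a).hom = p₀ ≫ i₀ :=
    fun a => comp_hom_eq_of_mem_zpowers g.val (p₀ ≫ i₀) hp₀ a.val a.property
  obtain ⟨t₀, ht₀, -⟩ := hj.existsUnique_fac (p₀ ≫ i₀) hinv₀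
  obtain ⟨k₀, rfl⟩ := SplitPoints.exists_eq x hx t₀
  refine ⟨k₀, ⟨p₀, ht₀.symm⟩, fun k hk p hp => hk ?_⟩
  -- uniqueness: both `x k₀ ≫ j` and `x k ≫ j` are `g`-fixed and `ι₀`-fixed points of `K`
  -- the `Γ`-set of `g`-fixed points and the involution induced by `ι₀`
  let S := {y : 𝟙_ (Motives.SchemeOver ℂ) ⟶ K // y ≫ g.val.hom = y}
  have hact_mem : ∀ (γ : autFixingH2H3 K) (y : S), (y.val ≫ γ.val.hom) ≫ g.val.hom = y.val ≫ γ.val.hom := by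
    intro γ y
    have hγg : γ.val.hom ≫ g.val.hom = g.val.hom ≫ γ.val.hom := by
      have := congrArg (fun δ : autFixingH2H3 K => δ.val.hom) (hcomm g γ)
      simpa [Subgroup.coe_mul, Aut.Aut_mul_def] using this
    rw [Category.assoc, hγg, ← Category.assoc, y.property]
  let act : autFixingH2H3 K → S → S := fun γ y => ⟨y.val ≫ γ.val.hom, hact_mem γ y⟩
  have hιg : ι₀.hom ≫ g.val.hom ≫ ι₀.hom = g.val.inv := by
    have h' := congrArg Iso.hom (hd.conj_eq_inv g.val g.2)
    simp only [Aut.Aut_mul_def, Aut.Aut_inv_def, Iso.trans_hom, Iso.symm_hom] at h'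
    exact h'
  have hι2 : ι₀.hom ≫ ι₀.hom = 𝟙 K := by
    have h' := congrArg Iso.hom hd.mul_self
    simp only [Aut.Aut_mul_def, Iso.trans_hom] at h'
    exact h'
  have hσ_mem : ∀ y : S, (y.val ≫ ι₀.hom) ≫ g.val.hom = y.val ≫ ι₀.hom := by
    intro y
    -- `ι₀ g = g⁻¹ ι₀`, and `y` is `g⁻¹`-fixed
    have hyinv : y.val ≫ g.val.inv = y.val := by
      calc y.val ≫ g.val.inv = (y.val ≫ g.val.hom) ≫ g.val.inv := by rw [y.property]
        _ = y.val := by rw [Category.assoc, Iso.hom_inv_id, Category.comp_id]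
    have key : ι₀.hom ≫ g.val.hom = g.val.inv ≫ ι₀.hom := by
      calc ι₀.hom ≫ g.val.hom = (ι₀.hom ≫ g.val.hom ≫ ι₀.hom) ≫ ι₀.hom := by
            simp only [Category.assoc, hι2, Category.comp_id]
        _ = g.val.inv ≫ ι₀.hom := by rw [hιg]
    rw [Category.assoc, key, ← Category.assoc, hyinv]
  let σ : S → S := fun y => ⟨y.val ≫ ι₀.hom, hσ_mem y⟩
  have hσ : ∀ γ (a : S), σ (act γ a) = act γ⁻¹ (σ a) := by
    intro γ a
    -- `γ ι₀ = ι₀ γ⁻¹`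
    have hγ : ι₀.hom ≫ γ.val.hom ≫ ι₀.hom = γ.val.inv := by
      have h' := congrArg Iso.hom (hd.conj_eq_inv γ.val γ.2)
      simp only [Aut.Aut_mul_def, Aut.Aut_inv_def, Iso.trans_hom, Iso.symm_hom] at h'
      exact h'
    have key : γ.val.hom ≫ ι₀.hom = ι₀.hom ≫ γ.val.inv := by
      calc γ.val.hom ≫ ι₀.hom = ι₀.hom ≫ (ι₀.hom ≫ γ.val.hom ≫ ι₀.hom) := by
            rw [← Category.assoc ι₀.hom, hι2, Category.id_comp]
        _ = ι₀.hom ≫ γ.val.inv := by rw [hγ]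
    have h : (a.val ≫ γ.val.hom) ≫ ι₀.hom = (a.val ≫ ι₀.hom) ≫ γ.val.inv := by
      rw [Category.assoc, key, Category.assoc]
    exact Subtype.ext h
  have hodd : ∀ γ : autFixingH2H3 K, ∃ m : ℕ, γ ^ (2 * m + 1) = 1 :=
    fun γ => exists_pow_odd_eq_one_of_card hcard γ
  have htrans : ∀ a b : S, ∃ γ, act γ a = b := by
    intro a b
    obtain ⟨γ, hγ⟩ := hH2 hA hKum hK8 g hg a.val b.val a.property b.property
    exact ⟨γ, Subtype.ext hγ⟩
  -- the two points
  let a : S := ⟨x k₀ ≫ j, by rw [Category.assoc, hjg]⟩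
  let b : S := ⟨x k ≫ j, by rw [Category.assoc, hjg]⟩
  have ha' : (x k₀ ≫ j) ≫ ι₀.hom = x k₀ ≫ j := by rw [ht₀, Category.assoc, hd.comp_hom]
  have hb' : (x k ≫ j) ≫ ι₀.hom = x k ≫ j := by rw [← hp, Category.assoc, hd.comp_hom]
  have ha : σ a = a := Subtype.ext ha'
  have hb : σ b = b := Subtype.ext hb'
  have hab : a = b :=
    eq_of_fixed_of_transitive act
      (fun s => Subtype.ext (Category.comp_id s.val : s.val ≫ (1 : autFixingH2H3 K).val.hom = s.val))
      (fun p q s => Subtype.ext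
        ((Category.assoc s.val q.val.hom p.val.hom).symm :
          s.val ≫ (p * q).val.hom = (s.val ≫ q.val.hom) ≫ p.val.hom))
      hodd htrans σ hσ ha hb
  have hjj : x k₀ ≫ j = x k ≫ j := congrArg Subtype.val hab
  have hxx : x k₀ = x k := (cancel_mono j).1 hjj
  exact (SplitPoints.injective x hx hxx).symm

/-- **H3 for `Kum⁴`-type and its powers from print, L1 and ONE FIXED POINT** — the rung from
fourteen printed statements (the eleven REFEREED facts of `hc_kum4Type_of_L1_of_meetsTranslates`,
Floccari–Varesco `Γ ≅ (ℤ/5)⁴`, the cohomological transport (T), Oguiso's split fixed points), the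
transitivity (H2) (printed synthesis, inline), p1's cell lemma L1, and the ATOM (H3) "the fixed
fourfold of every Kummer datum on `K⁴(A)` contains a `g`-fixed point".  CONDITIONAL on all of them. -/
theorem hc_kum4Type_of_L1_of_hasFixedPoint
    (hOGV : OGradyVoisin2022_thirdJacobian_kugaSatake_kummerType)
    (hFF : HodgeTheory.FloccariFu2026_hodgeClasses_algebraic_powers_discOneWeilFourfold)
    (hFo : Foster2024_lefschetzStandard_kummerType_prime)
    (hAn : HodgeTheory.Andre1996_dualLefschetz_mem_adjoin_lefschetzInvolution)
    (hA1 : HodgeTheory.Hirzebruch1969_gSignature_involution_halfDimFixedLocus)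
    (hA2 : Floccari2026_fixedFourfold_kum4Type)
    (hHIR : HodgeTheory.Voisin2002_hodgeIndex_hodgeRiemann_middle)
    (hGS : GoettscheSoergel1993_chiY_kum4Type)
    (hGK : GreenKimLazaRobles2022_llvTrivial_isOfHodgeType_kumType)
    (hF : Foster2024_translationAction_kum4Type)
    (hcardF : Floccari2026_card_autFixingH2H3_kum4Type)
    (hFu : HodgeTheory.Fulton1998_cupPairing_transversalPoint)
    (hFV : FloccariVaresco2024_autFixingH2H3_equiv_kumType)
    (hT : HassettTschinkel2013_Floccari2026_fixedFourfoldClass_transport_kum4Type)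
    (hOg : Oguiso2020_fixedPointScheme_translation_generalizedKummerFour)
    (hH2 : Oguiso2020_translations_transitive_fixedPoints_generalizedKummerFour)
    (hL1 : LefschetzGenerationKum4)
    (hH3 : Kum4FixedFourfoldHasFixedPointAtKummer) :
    Summit.Ventures.HodgeKum4.HC_Kum4Type ∧ Summit.Ventures.HodgeKum4.HC_Kum4TypePowers :=
  hc_kum4Type_of_L1_of_pointCount hOGV hFF hFo hAn hA1 hA2 hHIR hGS hGK hF hcardF hFu hT hOg hL1
    (kum4FixedPointCountAtKummer_of_transitive_of_hasFixedPoint hFV hH2 hH3)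

end Summit.Ventures.HodgeKum4

end
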